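import Literature.MathematicalPhysics.QuantumFieldTheory.Sweep1ChatterjeeFreeEnergyProofs
import HarnessLib

/-!
# Weak-coupling a-priori bounds for a unitary representation — crux `FreeEnergyLogCoefficient`, line Sketch, stub `weakCoupling` (Chatterjee §§7, 8, 10)

Route `EquipartitionCriticality` of `QuantumFields/YangMills`. Port of the tree's `U(N)` file
`WilsonWeakCouplingBounds` (namespace `WilsonWeakCoupling`; S. Chatterjee, *The leading term of the
Yang–Mills free energy*, J. Funct. Anal. 271 (2016), arXiv:1602.01222, §§7, 8, 10) from `G = U(N)`
with its defining representation to an ARBITRARY compact group `G` with a continuous representation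
`ρ : G →* M_N(ℂ)` by unitary matrices; the small-ball bound of Cor. 6.3,
`σ{g | ‖ρ g - 1‖_F ≤ δ} ≥ C₁ δ^D` (`0 < δ ≤ 1`), is a HYPOTHESIS (`hball`). Contents:
`WeakCoupling.S_eq` (Lemma 7.2), `norm_one_sub_sq_le_l1_mul_S` (Lemma 10.2 along `ρ`), `Z_le_one`,
`exists_Z_ge` (**Thm. 7.1**), `Z_le_two_mul_setLIntegral` (**Cor. 8.2**),
`Z_le_two_mul_lintegral_free` (**Thm. 10.1**, radius `WilsonWeakCoupling.rho0 C d n β`) and the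
registered conjunction `stub_weakCoupling`. No definitions, no named facts.
-/

noncomputable section

open scoped Matrix Matrix.Norms.Frobenius ENNReal NNReal
open MeasureTheory Measure Filter Topology Set
open Literature.Probability.LatticeModels Literature.MathematicalPhysics.QuantumLattice
open Literature.MathematicalPhysics.QuantumFieldTheory

namespace Summit.QuantumFields.YangMills.Theorems.FreeEnergyLogCoefficient

namespace WeakCoupling

open Finset Literature.MathematicalPhysics.QuantumFieldTheory.UnitaryCayley
open Literature.MathematicalPhysics.QuantumFieldTheory.AxialGauge

section Algebra

variable {d N : ℕ} {G : Type*} [Group G] (ρ : G →* Matrix (Fin N) (Fin N) ℂ)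

/-! ### The Wilson action in Hilbert–Schmidt form and unitary geometry along `ρ` -/

/-- `N - Re tr ρ(g) = ½ ‖1 - ρ(g)‖²` for unitary `ρ(g)` (Lemma 7.2). [cite: arXiv160201222, Lemma 7.2] -/
theorem sub_re_trace_eq (hU : ∀ g, ρ g ∈ Matrix.unitaryGroup (Fin N) ℂ) (g : G) :
    (N : ℝ) - (ρ g).trace.re = ‖1 - ρ g‖ ^ 2 / 2 := by
  rw [← re_trace_one_sub (hU g), Matrix.trace_sub, Complex.sub_re, Matrix.trace_one, Fintype.card_fin]
  simp

/-- **The Wilson action in Hilbert–Schmidt form**: `S_{B_n}(U) = ½ Σ_p ‖1 - ρ(U_p)‖²`. [cite: arXiv160201222, Lemma 7.2] -/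
theorem S_eq (hU : ∀ g, ρ g ∈ Matrix.unitaryGroup (Fin N) ℂ) (n : ℕ) (U : ZdGaugeConfig d G) :
    zdWilsonAction ρ (halfOpenBox d n) U =
      ∑ p ∈ plaquettesIn (halfOpenBox d n), ‖1 - ρ (U.plaquette p.1 p.2.1 p.2.2)‖ ^ 2 / 2 := by
  unfold zdWilsonAction
  exact Finset.sum_congr rfl fun p _ => by rw [sub_re_trace_eq ρ hU]

/-- `S ≥ 0`. [cite: arXiv160201222, §4] -/
theorem S_nonneg (hU : ∀ g, ρ g ∈ Matrix.unitaryGroup (Fin N) ℂ) (n : ℕ) (U : ZdGaugeConfig d G) :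
    0 ≤ zdWilsonAction ρ (halfOpenBox d n) U := by
  rw [S_eq ρ hU]; exact Finset.sum_nonneg fun _ _ => by positivity

/-- `‖1 - ρ(g⁻¹)‖ = ‖1 - ρ(g)‖` (Lemma 7.5 along `ρ`). [cite: arXiv160201222, Lemma 7.5] -/
theorem norm_one_sub_map_inv (hU : ∀ g, ρ g ∈ Matrix.unitaryGroup (Fin N) ℂ) (g : G) :
    ‖1 - ρ g⁻¹‖ = ‖1 - ρ g‖ := by
  have h := norm_one_sub_inv (ρ.codRestrict (Matrix.unitaryGroup (Fin N) ℂ) hU g)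
  rwa [← map_inv] at h

/-- `‖1 - ρ(a b)‖ ≤ ‖1 - ρ(a)‖ + ‖1 - ρ(b)‖` (Lemma 7.4 along `ρ`). [cite: arXiv160201222, Lemma 7.4] -/
theorem norm_one_sub_map_mul_le (hU : ∀ g, ρ g ∈ Matrix.unitaryGroup (Fin N) ℂ) (a b : G) :
    ‖1 - ρ (a * b)‖ ≤ ‖1 - ρ a‖ + ‖1 - ρ b‖ := by
  rw [map_mul]
  exact norm_one_sub_mul_le ⟨ρ a, hU a⟩ (ρ b)

/-- `‖1 - ρ(U_p)‖ ≤ Σ_{e ∈ ∂p} ‖1 - ρ(U_e)‖` for a plaquette holonomy (proof of Thm. 7.1). [cite: arXiv160201222, Lemma 7.4] -/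
theorem norm_one_sub_map_plaquette_le (hU : ∀ g, ρ g ∈ Matrix.unitaryGroup (Fin N) ℂ)
    (U : ZdGaugeConfig d G) (x : Literature.Probability.LatticeModels.Site d) (i j : Fin d) :
    ‖1 - ρ (U.plaquette x i j)‖ ≤ ‖1 - ρ (U (x, i))‖ + ‖1 - ρ (U (x + Pi.single i 1, j))‖ +
      ‖1 - ρ (U (x + Pi.single j 1, i))‖ + ‖1 - ρ (U (x, j))‖ := by
  have h := norm_one_sub_plaquetteWord_le (ρ.codRestrict (Matrix.unitaryGroup (Fin N) ℂ) hU (U (x, i)))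
    (ρ.codRestrict _ hU (U (x + Pi.single i 1, j))) (ρ.codRestrict _ hU (U (x + Pi.single j 1, i)))
    (ρ.codRestrict _ hU (U (x, j)))
  rwa [← map_inv, ← map_inv, ← map_mul, ← map_mul, ← map_mul] at h

/-- **Lemma 10.2 (discrete nonlinear Poincaré inequality) along `ρ`**: for a configuration `U` on
`B_n` in axial gauge (`U = 1` on the comb tree) and every edge `(x, j)` of `B_n`,
`‖1 - ρ(U(x,j))‖² ≤ 2 |x|₁ S_{B_n}(U)`. [cite: arXiv160201222, Lemma 10.2] -/
theorem norm_one_sub_sq_le_l1_mul_S (hU : ∀ g, ρ g ∈ Matrix.unitaryGroup (Fin N) ℂ) {n : ℕ}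
    (v : FreeCfg d G n) {e : Literature.MathematicalPhysics.QuantumFieldTheory.ZdEdge d}
    (he : e ∈ boxEdges d n) :
    ‖1 - ρ (ext (ext₁ v) e)‖ ^ 2 ≤ 2 * l1 e.1 * zdWilsonAction ρ (halfOpenBox d n) (ext (ext₁ v)) := by
  have h := sq_le_l1_mul_sum (G := G) (ℓ := fun g : G => ‖1 - ρ g‖) (fun _ => norm_nonneg _)
    (norm_one_sub_map_mul_le ρ hU) (norm_one_sub_map_inv ρ hU) (n := n) (U := ext (ext₁ v))
    (fun e' he' hc => by
      show ‖1 - ρ (ext (ext₁ v) e')‖ = 0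
      rw [ext_apply_of_mem _ he', ext₁_apply_of_isComb _ hc, map_one, sub_self, norm_zero]) he
  rw [S_eq ρ hU]
  calc ‖1 - ρ (ext (ext₁ v) e)‖ ^ 2
      ≤ l1 e.1 * ∑ p ∈ plaquettesIn (halfOpenBox d n),
          ‖1 - ρ ((ext (ext₁ v)).plaquette p.1 p.2.1 p.2.2)‖ ^ 2 := h
    _ = 2 * l1 e.1 * ∑ p ∈ plaquettesIn (halfOpenBox d n),
          ‖1 - ρ ((ext (ext₁ v)).plaquette p.1 p.2.1 p.2.2)‖ ^ 2 / 2 := by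
        rw [← Finset.sum_div]; ring

/-- On the product ball `{‖ρ(u_e) - 1‖ ≤ δ ∀ e}` every plaquette holonomy is within `4δ` of `1`
and `S_{B_n} ≤ 8 δ² |B_n'|` (proof of Thm. 7.1). [cite: arXiv160201222, Thm. 7.1 (proof)] -/
theorem S_ext_le_of_mem_pi_ball (hU : ∀ g, ρ g ∈ Matrix.unitaryGroup (Fin N) ℂ) {n : ℕ} {δ : ℝ}
    {u : BoxCfg d G n} (hu : u ∈ Set.pi Set.univ fun _ => {g : G | ‖ρ g - 1‖ ≤ δ}) :
    zdWilsonAction ρ (halfOpenBox d n) (ext u) ≤ 8 * δ ^ 2 * #(plaquettesIn (halfOpenBox d n)) := by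
  rw [S_eq ρ hU]
  have hball : ∀ {e}, e ∈ boxEdges d n → ‖1 - ρ (ext u e)‖ ≤ δ := fun {e} he => by
    rw [ext_apply_of_mem _ he, ← norm_neg, neg_sub]
    exact hu ⟨e, he⟩ (Set.mem_univ _)
  calc ∑ p ∈ plaquettesIn (halfOpenBox d n), ‖1 - ρ ((ext u).plaquette p.1 p.2.1 p.2.2)‖ ^ 2 / 2
      ≤ ∑ _p ∈ plaquettesIn (halfOpenBox d n), (4 * δ) ^ 2 / 2 := by
        refine Finset.sum_le_sum fun p hp => ?_
        obtain ⟨h1, h2, h3, h4⟩ := edges_mem_boxEdges hp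
        have hle : ‖1 - ρ ((ext u).plaquette p.1 p.2.1 p.2.2)‖ ≤ 4 * δ := by
          refine (norm_one_sub_map_plaquette_le ρ hU (ext u) p.1 p.2.1 p.2.2).trans ?_
          linarith [hball h1, hball h2, hball h3, hball h4]
        gcongr
    _ = 8 * δ ^ 2 * #(plaquettesIn (halfOpenBox d n)) := by
        rw [Finset.sum_const, nsmul_eq_mul]; ring

end Algebra

section Integrals

variable {d N : ℕ} {G : Type*} [Group G] [TopologicalSpace G] [IsTopologicalGroup G]
  [MeasurableSpace G] [BorelSpace G] [SecondCountableTopology G] (ρ : G →* Matrix (Fin N) (Fin N) ℂ)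

/-- The Wilson action of the box as a function of box configurations is measurable. [folklore] -/
theorem measurable_S_ext (hρ : Continuous ρ) (n : ℕ) :
    Measurable fun u : BoxCfg d G n => zdWilsonAction ρ (halfOpenBox d n) (ext u) :=
  (AreaLaw.continuous_zdWilsonAction ρ hρ _).measurable.comp measurable_ext

variable [CompactSpace G]

/-- `Z(B_n, β) ≤ 1` for `β ≥ 0`. [cite: arXiv160201222, §17] -/
theorem Z_le_one (hρ : Continuous ρ) (hU : ∀ g, ρ g ∈ Matrix.unitaryGroup (Fin N) ℂ) (n : ℕ)
    {β : ℝ} (hβ : 0 ≤ β) : zdPartitionFunction ρ β (halfOpenBox d n) ≤ 1 := by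
  rw [zdPartitionFunction_eq_lintegral_pi ρ hρ β n]
  calc ∫⁻ u, ENNReal.ofReal (Real.exp (-β * zdWilsonAction ρ (halfOpenBox d n) (ext u)))
        ∂(Measure.pi fun _ => haarProbability G)
      ≤ ∫⁻ _u, 1 ∂(Measure.pi fun _ : ↥(boxEdges d n) => haarProbability G) :=
        lintegral_mono fun u => ENNReal.ofReal_le_one.2 (Real.exp_le_one_iff.2 (by
          have := S_nonneg ρ hU n (ext u); nlinarith))
    _ = 1 := by rw [lintegral_const, measure_univ, mul_one]

/-- **Theorem 7.1 (lower bound for the partition function)** for `ρ(G) ⊆ U(N)`, with the small-ball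
bound `σ{‖ρ g - 1‖ ≤ δ} ≥ C₁ δ^D` (`0 < δ ≤ 1`) as hypothesis: there is `C > 0` with
`Z(B_n, β) ≥ exp(-C n^d log β)` for all `n` and all `β ≥ 2`. Proof as printed: restrict to the
product of Hilbert–Schmidt balls of radius `δ = (8β)^{-1/2}` around `1`, where `β S ≤ |B_n'|`. [cite: arXiv160201222, Thm. 7.1] -/
theorem exists_Z_ge (hρ : Continuous ρ) (hU : ∀ g, ρ g ∈ Matrix.unitaryGroup (Fin N) ℂ) {D : ℕ}
    {C₁ : ℝ} (hC₁ : 0 < C₁)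
    (hball : ∀ δ : ℝ, 0 < δ → δ ≤ 1 →
      ENNReal.ofReal (C₁ * δ ^ D) ≤ haarProbability G {g : G | ‖ρ g - 1‖ ≤ δ}) :
    ∃ C : ℝ, 0 < C ∧ ∀ (n : ℕ) (β : ℝ), 2 ≤ β →
      ENNReal.ofReal (Real.exp (-(C * n ^ d * Real.log β))) ≤
        zdPartitionFunction ρ β (halfOpenBox d n) := by
  set A : ℝ := d * d - d * Real.log C₁ + d * D / 2 * Real.log 8 with hA
  set C : ℝ := d * D / 2 + max A 0 / Real.log 2 + 1 with hC
  have hlog2 : 0 < Real.log 2 := Real.log_pos one_lt_two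
  have hCpos : 0 < C := by positivity
  refine ⟨C, hCpos, fun n β hβ => ?_⟩
  have hβ0 : 0 < β := by linarith
  set δ : ℝ := (Real.sqrt (8 * β))⁻¹ with hδ
  have h8β : 0 < 8 * β := by linarith
  have hδpos : 0 < δ := inv_pos.2 (Real.sqrt_pos.2 h8β)
  have hδsq : δ ^ 2 = (8 * β)⁻¹ := by rw [hδ, inv_pow, Real.sq_sqrt h8β.le]
  have hδ1 : δ ≤ 1 := inv_le_one_of_one_le₀ (Real.one_le_sqrt.2 (by linarith))
  -- the product ball and the bound on it
  set E := boxEdges d n with hE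
  set π := Measure.pi fun _ : ↥E => haarProbability G with hπ
  set T : Set (BoxCfg d G n) := Set.pi Set.univ fun _ => {g : G | ‖ρ g - 1‖ ≤ δ} with hT
  set P := #(plaquettesIn (halfOpenBox d n)) with hP
  have hST : ∀ u ∈ T, ENNReal.ofReal (Real.exp (-(P : ℝ))) ≤
      ENNReal.ofReal (Real.exp (-β * zdWilsonAction ρ (halfOpenBox d n) (ext u))) := fun u hu => by
    apply ENNReal.ofReal_le_ofReal
    apply Real.exp_le_exp.2
    have h := S_ext_le_of_mem_pi_ball ρ hU hu
    have : β * zdWilsonAction ρ (halfOpenBox d n) (ext u) ≤ β * (8 * δ ^ 2 * P) :=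
      mul_le_mul_of_nonneg_left h hβ0.le
    rw [hδsq] at this
    have e : β * (8 * (8 * β)⁻¹ * (P : ℝ)) = P := by field_simp
    linarith
  -- measure of the product ball
  have hπT : (ENNReal.ofReal (C₁ * δ ^ D)) ^ (d * n ^ d) ≤ π T := by
    rw [hπ, hT, Measure.pi_pi, Finset.prod_const, Finset.card_univ, Fintype.card_coe]
    have hx1 : ENNReal.ofReal (C₁ * δ ^ D) ≤ 1 := (hball δ hδpos hδ1).trans prob_le_one
    calc (ENNReal.ofReal (C₁ * δ ^ D)) ^ (d * n ^ d)
        ≤ (ENNReal.ofReal (C₁ * δ ^ D)) ^ #E :=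
          pow_le_pow_right_of_le_one' hx1 (WilsonWeakCoupling.card_boxEdges_le n)
      _ ≤ (haarProbability G {g : G | ‖ρ g - 1‖ ≤ δ}) ^ #E := by gcongr; exact hball δ hδpos hδ1
  -- assemble in `ℝ≥0∞`
  have hmain : ENNReal.ofReal (Real.exp (-(P : ℝ))) * (ENNReal.ofReal (C₁ * δ ^ D)) ^ (d * n ^ d) ≤
      zdPartitionFunction ρ β (halfOpenBox d n) := by
    rw [zdPartitionFunction_eq_lintegral_pi ρ hρ β n]
    calc ENNReal.ofReal (Real.exp (-(P : ℝ))) * (ENNReal.ofReal (C₁ * δ ^ D)) ^ (d * n ^ d)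
        ≤ ENNReal.ofReal (Real.exp (-(P : ℝ))) * π T := by gcongr
      _ = ∫⁻ _u in T, ENNReal.ofReal (Real.exp (-(P : ℝ))) ∂π := by rw [setLIntegral_const]
      _ ≤ ∫⁻ u in T, ENNReal.ofReal (Real.exp (-β * zdWilsonAction ρ (halfOpenBox d n) (ext u))) ∂π :=
          setLIntegral_mono ((ENNReal.measurable_ofReal.comp (Real.measurable_exp.comp
            ((measurable_S_ext ρ hρ n).const_mul _)))) hST
      _ ≤ ∫⁻ u, ENNReal.ofReal (Real.exp (-β * zdWilsonAction ρ (halfOpenBox d n) (ext u))) ∂π :=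
          setLIntegral_le_lintegral _ _
  refine le_trans ?_ hmain
  -- the real-number inequality `exp(-C n^d log β) ≤ exp(-P) (C₁ δ^D)^{d n^d}`
  have hx : 0 < C₁ * δ ^ D := by positivity
  rw [← ENNReal.ofReal_pow hx.le, ← ENNReal.ofReal_mul (Real.exp_pos _).le]
  apply ENNReal.ofReal_le_ofReal
  rw [← Real.exp_log (pow_pos hx (d * n ^ d)), ← Real.exp_add, Real.exp_le_exp, Real.log_pow,
    Real.log_mul hC₁.ne' (pow_pos hδpos _).ne', Real.log_pow]
  have hlogδ : Real.log δ = -(Real.log 8 + Real.log β) / 2 := by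
    rw [hδ, Real.log_inv, Real.log_sqrt h8β.le, Real.log_mul (by norm_num) hβ0.ne']
    ring
  rw [hlogδ]
  have hPle : (P : ℝ) ≤ d * d * (n : ℝ) ^ d := by exact_mod_cast card_plaquettesIn_le n
  have hLβ : Real.log 2 ≤ Real.log β := Real.log_le_log two_pos hβ
  have hnd : (0 : ℝ) ≤ (n : ℝ) ^ d := by positivity
  have hmax : A ≤ max A 0 / Real.log 2 * Real.log β := by
    calc A ≤ max A 0 := le_max_left _ _
      _ = max A 0 / Real.log 2 * Real.log 2 := by field_simp
      _ ≤ max A 0 / Real.log 2 * Real.log β := by gcongr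
  -- `-C n^d log β ≤ -P + d n^d (log C₁ + D (-(log 8 + log β)/2))`
  have key : C * (n : ℝ) ^ d * Real.log β ≥
      d * d * (n : ℝ) ^ d -
        (d * n ^ d : ℕ) * (Real.log C₁ + (D : ℕ) * (-(Real.log 8 + Real.log β) / 2)) := by
    push_cast
    have e : (d : ℝ) * d * (n : ℝ) ^ d -
        d * (n : ℝ) ^ d * (Real.log C₁ + D * (-(Real.log 8 + Real.log β) / 2)) =
          (n : ℝ) ^ d * (A + d * D / 2 * Real.log β) := by rw [hA]; ring
    rw [e, ge_iff_le, show C * (n : ℝ) ^ d * Real.log β = (n : ℝ) ^ d * (C * Real.log β) by ring]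
    apply mul_le_mul_of_nonneg_left _ hnd
    rw [hC]
    nlinarith [hmax, hLβ, hlog2]
  linarith

/-- **Cor. 8.2 (reduction to nearly minimising configurations)** for `ρ(G) ⊆ U(N)`: with `C` as in
Thm. 7.1, for `β ≥ 2`, `Z(B_n, β) ≤ 2 ∫_{β S ≤ C n^d log β + log 2} e^{-β S} dσ_{B_n}` (off that set the
integrand is `< e^{-C n^d log β}/2 ≤ Z/2`). [cite: arXiv160201222, Cor. 8.2] -/
theorem Z_le_two_mul_setLIntegral (hρ : Continuous ρ) (hU : ∀ g, ρ g ∈ Matrix.unitaryGroup (Fin N) ℂ)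
    {C : ℝ} (hC : ∀ (n : ℕ) (β : ℝ), 2 ≤ β →
      ENNReal.ofReal (Real.exp (-(C * n ^ d * Real.log β))) ≤ zdPartitionFunction ρ β (halfOpenBox d n))
    (n : ℕ) {β : ℝ} (hβ : 2 ≤ β) :
    zdPartitionFunction ρ β (halfOpenBox d n) ≤
      2 * ∫⁻ u in {u | β * zdWilsonAction ρ (halfOpenBox d n) (ext u) ≤ C * n ^ d * Real.log β + Real.log 2},
        ENNReal.ofReal (Real.exp (-β * zdWilsonAction ρ (halfOpenBox d n) (ext u)))
          ∂(Measure.pi fun _ : ↥(boxEdges d n) => haarProbability G) := by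
  set π := Measure.pi fun _ : ↥(boxEdges d n) => haarProbability G with hπ
  set A := {u : BoxCfg d G n |
    β * zdWilsonAction ρ (halfOpenBox d n) (ext u) ≤ C * n ^ d * Real.log β + Real.log 2} with hA
  set f := fun u : BoxCfg d G n =>
    ENNReal.ofReal (Real.exp (-β * zdWilsonAction ρ (halfOpenBox d n) (ext u))) with hf
  have hAm : MeasurableSet A :=
    measurableSet_le ((measurable_S_ext ρ hρ n).const_mul β) measurable_const
  have hZfin : zdPartitionFunction ρ β (halfOpenBox d n) ≠ ∞ :=
    ne_top_of_le_ne_top ENNReal.one_ne_top (Z_le_one ρ hρ hU n (by linarith))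
  -- off `A` the integrand is small
  have hcompl : ∫⁻ u in Aᶜ, f u ∂π ≤ zdPartitionFunction ρ β (halfOpenBox d n) / 2 := by
    have hb : ∀ u ∈ Aᶜ, f u ≤ ENNReal.ofReal (Real.exp (-(C * n ^ d * Real.log β))) / 2 := by
      intro u hu
      simp only [hA, Set.mem_compl_iff, Set.mem_setOf_eq, not_le] at hu
      rw [hf]
      dsimp only
      rw [show ENNReal.ofReal (Real.exp (-(C * n ^ d * Real.log β))) / 2 =
          ENNReal.ofReal (Real.exp (-(C * n ^ d * Real.log β)) / 2) by
        rw [ENNReal.ofReal_div_of_pos two_pos]; norm_num]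
      apply ENNReal.ofReal_le_ofReal
      rw [div_eq_mul_inv, ← Real.exp_log two_pos, ← Real.exp_neg, ← Real.exp_add]
      exact Real.exp_le_exp.2 (by linarith)
    calc ∫⁻ u in Aᶜ, f u ∂π
        ≤ ∫⁻ _u in Aᶜ, ENNReal.ofReal (Real.exp (-(C * n ^ d * Real.log β))) / 2 ∂π :=
          setLIntegral_mono measurable_const hb
      _ = ENNReal.ofReal (Real.exp (-(C * n ^ d * Real.log β))) / 2 * π Aᶜ := setLIntegral_const _ _
      _ ≤ ENNReal.ofReal (Real.exp (-(C * n ^ d * Real.log β))) / 2 * 1 := by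
          gcongr; exact prob_le_one
      _ ≤ zdPartitionFunction ρ β (halfOpenBox d n) / 2 := by
          rw [mul_one]; exact ENNReal.div_le_div_right (hC n β hβ) 2
  have hsplit : zdPartitionFunction ρ β (halfOpenBox d n) = ∫⁻ u in A, f u ∂π + ∫⁻ u in Aᶜ, f u ∂π := by
    rw [zdPartitionFunction_eq_lintegral_pi ρ hρ β n, ← hπ, lintegral_add_compl f hAm]
  have h1 : zdPartitionFunction ρ β (halfOpenBox d n) ≤
      ∫⁻ u in A, f u ∂π + zdPartitionFunction ρ β (halfOpenBox d n) / 2 := by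
    conv_lhs => rw [hsplit]
    gcongr
  have h2 : zdPartitionFunction ρ β (halfOpenBox d n) / 2 ≤ ∫⁻ u in A, f u ∂π := by
    have h := h1
    conv_lhs at h => rw [← ENNReal.add_halves (zdPartitionFunction ρ β (halfOpenBox d n))]
    exact ENNReal.le_of_add_le_add_right (ENNReal.div_ne_top hZfin two_ne_zero) h
  calc zdPartitionFunction ρ β (halfOpenBox d n) = 2 * (zdPartitionFunction ρ β (halfOpenBox d n) / 2) :=
        (ENNReal.mul_div_cancel two_ne_zero ENNReal.ofNat_ne_top).symm
    _ ≤ 2 * ∫⁻ u in A, f u ∂π := by gcongr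

/-- **Theorem 10.1 (upper bound: reduction to a neighbourhood of the identity in axial gauge)** for
`ρ(G) ⊆ U(N)`: with `C` as in Thm. 7.1 and `ρ₀ = (2 d n (C n^d log β + log 2)/β)^{1/2}`
(`WilsonWeakCoupling.rho0`), for `β ≥ 2`,
`Z(B_n, β) ≤ 2 ∫_{G^{E_n^1}} 1_{‖ρ(v_e) - 1‖ ≤ ρ₀ ∀ e} e^{-β S(1 on E_n^0, v)} dσ^{E_n^1}(v)`.
Proof as printed: Cor. 8.2, Cor. 9.4 (gauge fixing) and the discrete Poincaré inequality Lemma 10.2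
(`‖1 - ρ(U(x,j))‖² ≤ 2|x|₁ S ≤ 2 d n S`). [cite: arXiv160201222, Thm. 10.1] -/
theorem Z_le_two_mul_lintegral_free (hρ : Continuous ρ) (hU : ∀ g, ρ g ∈ Matrix.unitaryGroup (Fin N) ℂ)
    {C : ℝ} (hC : ∀ (n : ℕ) (β : ℝ), 2 ≤ β →
      ENNReal.ofReal (Real.exp (-(C * n ^ d * Real.log β))) ≤ zdPartitionFunction ρ β (halfOpenBox d n))
    (n : ℕ) {β : ℝ} (hβ : 2 ≤ β) :
    zdPartitionFunction ρ β (halfOpenBox d n) ≤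
      2 * ∫⁻ v in Set.pi Set.univ (fun _ => {g : G | ‖ρ g - 1‖ ≤ WilsonWeakCoupling.rho0 C d n β}),
        ENNReal.ofReal (Real.exp (-β * zdWilsonAction ρ (halfOpenBox d n) (ext (ext₁ v))))
          ∂(Measure.pi fun _ : WilsonWeakCoupling.FreeIdx d n => haarProbability G) := by
  have hβ0 : 0 < β := by linarith
  set A := {u : BoxCfg d G n |
    β * zdWilsonAction ρ (halfOpenBox d n) (ext u) ≤ C * n ^ d * Real.log β + Real.log 2} with hA
  set f := fun u : BoxCfg d G n =>
    ENNReal.ofReal (Real.exp (-β * zdWilsonAction ρ (halfOpenBox d n) (ext u))) with hf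
  have hAm : MeasurableSet A :=
    measurableSet_le ((measurable_S_ext ρ hρ n).const_mul β) measurable_const
  have hfm : Measurable f :=
    ENNReal.measurable_ofReal.comp (Real.measurable_exp.comp ((measurable_S_ext ρ hρ n).const_mul _))
  -- Cor. 8.2, written with an indicator
  have h1 := Z_le_two_mul_setLIntegral ρ hρ hU hC n hβ
  rw [← lintegral_indicator hAm] at h1
  -- gauge invariance of the indicator integrand, Cor. 9.4
  have hinv : ∀ u, A.indicator f (gaugeFixBox u) = A.indicator f u := fun u => by
    simp only [Set.indicator, hA, Set.mem_setOf_eq, hf, zdWilsonAction_ext_gaugeFixBox (ρ := ρ)]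
  have h2 := lintegral_pi_eq_lintegral_free (hfm.indicator hAm) hinv
  rw [h2] at h1
  refine h1.trans (mul_le_mul_right ?_ 2)
  -- pointwise: on `A`, the free variables are within `ρ₀` of `1` (Lemma 10.2)
  have hTm : MeasurableSet {g : G | ‖ρ g - 1‖ ≤ WilsonWeakCoupling.rho0 C d n β} :=
    (isClosed_le (hρ.sub continuous_const).norm continuous_const).measurableSet
  rw [← lintegral_indicator (MeasurableSet.univ_pi fun _ => hTm)]
  refine lintegral_mono fun v => ?_
  by_cases hv : ext₁ v ∈ A
  · rw [Set.indicator_of_mem hv]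
    have hT : v ∈ Set.pi Set.univ fun _ => {g : G | ‖ρ g - 1‖ ≤ WilsonWeakCoupling.rho0 C d n β} := by
      intro e _
      rw [Set.mem_setOf_eq, ← norm_neg, neg_sub]
      have hPo := norm_one_sub_sq_le_l1_mul_S ρ hU v e.1.2
      rw [ext_apply_of_mem _ e.1.2, ext₁_apply_of_not_isComb _ e.2] at hPo
      have hl1 : (l1 e.1.1.1 : ℝ) ≤ d * n := by exact_mod_cast l1_le (mem_boxEdges.1 e.1.2).1
      have hS := S_nonneg ρ hU n (ext (ext₁ v))
      simp only [hA, Set.mem_setOf_eq] at hv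
      have hsq : ‖1 - ρ (v ⟨e.1, e.2⟩)‖ ^ 2 ≤
          2 * d * n * (C * n ^ d * Real.log β + Real.log 2) / β := by
        rw [le_div_iff₀ hβ0]
        calc ‖1 - ρ (v ⟨e.1, e.2⟩)‖ ^ 2 * β
            ≤ 2 * l1 e.1.1.1 * zdWilsonAction ρ (halfOpenBox d n) (ext (ext₁ v)) * β :=
              mul_le_mul_of_nonneg_right hPo hβ0.le
          _ = 2 * l1 e.1.1.1 * (β * zdWilsonAction ρ (halfOpenBox d n) (ext (ext₁ v))) := by ring
          _ ≤ 2 * (d * n) * (C * n ^ d * Real.log β + Real.log 2) := by gcongr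
          _ = 2 * d * n * (C * n ^ d * Real.log β + Real.log 2) := by ring
      calc ‖1 - ρ (v e)‖ = Real.sqrt (‖1 - ρ (v ⟨e.1, e.2⟩)‖ ^ 2) := by
            rw [Real.sqrt_sq (norm_nonneg _)]
        _ ≤ WilsonWeakCoupling.rho0 C d n β := Real.sqrt_le_sqrt hsq
    rw [Set.indicator_of_mem hT]
  · rw [Set.indicator_of_notMem hv]; exact zero_le

end Integrals

end WeakCoupling

section Group

variable {d N : ℕ} {G : Type*} [Group G] [TopologicalSpace G] [IsTopologicalGroup G]
  [CompactSpace G] [MeasurableSpace G] [BorelSpace G]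

/-- **STUB 4 — weak-coupling a-priori bounds for a unitary representation (Chatterjee §§7, 8, 10).**
`Z(B_n, β) ≤ 1` (`β ≥ 0`); Theorem 7.1 (`Z ≥ exp(−C n^d log β)`, `β ≥ 2`, from the small-ball lower
bound `σ(B(1,δ)) ≥ C₁ δ^D`); Theorem 10.1 (Cor. 8.2 + axial gauge Cor. 9.4 + the discrete Poincaré
inequality Lemma 10.2): `Z ≤ 2 ∫_{B(1,ρ₀)^{E_n^1}} e^{−βS(1, v)} dσ^{E_n^1}`. Port of
`WilsonWeakCoupling.{S_eq, Z_le_one, norm_one_sub_sq_le_l1_mul_S, exists_Z_ge,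
Z_le_two_mul_setLIntegral, Z_le_two_mul_lintegral_free}` from `𝔾 N` to `ρ(G) ⊆ U(N)`. [cite: arXiv160201222, Thm. 7.1, Cor. 8.2, Thm. 10.1] -/
theorem stub_weakCoupling [SecondCountableTopology G] (ρ : G →* Matrix (Fin N) (Fin N) ℂ)
    (hρ : Continuous ρ) (hU : ∀ g, ρ g ∈ Matrix.unitaryGroup (Fin N) ℂ) {D : ℕ} {C₁ : ℝ}
    (hC₁ : 0 < C₁)
    (hball : ∀ δ : ℝ, 0 < δ → δ ≤ 1 →
      ENNReal.ofReal (C₁ * δ ^ D) ≤ haarProbability G {g : G | ‖ρ g - 1‖ ≤ δ}) :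
    (∀ (n : ℕ) (β : ℝ), 0 ≤ β → zdPartitionFunction ρ β (halfOpenBox d n) ≤ 1) ∧
    ∃ C : ℝ, 0 < C ∧
      (∀ (n : ℕ) (β : ℝ), 2 ≤ β →
        ENNReal.ofReal (Real.exp (-(C * n ^ d * Real.log β))) ≤
          zdPartitionFunction ρ β (halfOpenBox d n)) ∧
      (∀ (n : ℕ) (β : ℝ), 2 ≤ β → zdPartitionFunction ρ β (halfOpenBox d n) ≤
        2 * ∫⁻ v in Set.pi Set.univ (fun _ => {g : G | ‖ρ g - 1‖ ≤ WilsonWeakCoupling.rho0 C d n β}),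
          ENNReal.ofReal (Real.exp (-β * zdWilsonAction ρ (halfOpenBox d n)
            (AxialGauge.ext (AxialGauge.ext₁ v))))
          ∂(Measure.pi fun _ : WilsonWeakCoupling.FreeIdx d n => haarProbability G)) := by
  obtain ⟨C, hC, h71⟩ := WeakCoupling.exists_Z_ge (d := d) ρ hρ hU hC₁ hball
  exact ⟨fun n β hβ => WeakCoupling.Z_le_one ρ hρ hU n hβ, C, hC, h71,
    fun n β hβ => WeakCoupling.Z_le_two_mul_lintegral_free ρ hρ hU h71 n hβ⟩

end Group

end Summit.QuantumFields.YangMills.Theorems.FreeEnergyLogCoefficient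

end
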